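import Summits.BirchSwinnertonDyer.BirchSwinnertonDyer.Theorems.TameQuarticSolventSolventPairLowerBoundTprimePadic
import HarnessLib

/-!
# Route `TameQuarticSolvent`, crux `SolventPairLowerBound` (stmt-BirchSwinnertonDyer-21391), line `birth` —
# the `ℤ₃` MEDIUM FORM of a (t′)-at-`3` curve, exported with the EXACT order of `a₄`

HONEST FRAMING. Theorems only; helper (`--supports stmt-BirchSwinnertonDyer-21391 --as helper`) for the
twist bookkeeping of the stub `stub_twistDatum` ((t′) is preserved, as `III ↔ III*`, by a quadratic twist
with `ord₃ d = 1`). BSD is not proved by any of this.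

WHAT. `exists_padicInt_mediumForm_of_subTprime` — for `W/ℚ` globally minimal, elliptic, `Addv W 3`,
`SubTprime W 3`: there are a `ℤ₃`-model `V` of `W ⊗ ℚ₃` (the integral model) and a change of variables `T`
over `ℤ₃` with `T • V = y² = x³ + A₂x² + A₄x + A₆` and EITHER `3 ∣ A₂`, `3 ∥ A₄`, `9 ∣ A₆`, `ord Δ = 3`
(Kodaira `III`) OR `9 ∣ A₂`, `27 ∥ A₄`, `3⁵ ∣ A₆`, `ord Δ = 9` (Kodaira `III*`). This is the companion files'
`exists_mediumForm_of_tprime` on the `3`-adic integral minimal model (same bookkeeping as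
`exists_rat_model_of_subTprime`), plus the exactness of `ord A₄`: were `9 ∣ A₄` (resp. `81 ∣ A₄`) the
discriminant would be divisible by `3⁴` (resp. `3¹⁰`) (`TateAlgorithm.pow_dvd_Δ_of_pow_dvd_a`).

References: J. H. Silverman, *ATAEC* IV.9.4 and Table 4.1; I. Papadopoulos, J. Number Theory 44 (1993) Table III.
-/

-- D-0017: single-problem summit, so `Summit.BirchSwinnertonDyer.BirchSwinnertonDyer.…` repeats a namespace BY DESIGN.
set_option linter.dupNamespace false

noncomputable section

open IsLocalRing IsDedekindDomain
open IsDiscreteValuationRing hiding maximalIdeal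
open Literature Literature.NumberTheory.DiophantineGeometry
  Literature.NumberTheory.DiophantineGeometry.TateAlgorithm
  Literature.NumberTheory.EllipticCurves Literature.NumberTheory.EllipticCurves.Rizzo
  Literature.NumberTheory.EllipticCurves.Rank1Residual
  Summit.BirchSwinnertonDyer.Rank1Residual.Additive

namespace Summit.BirchSwinnertonDyer.BirchSwinnertonDyer.Theorems.SolventPairLowerBound

variable (W : WeierstrassCurve ℚ) [W.IsElliptic] [W.IsGloballyMinimal]

/-- **The `ℤ₃` medium form of a (t′) curve, with the exact order of `a₄`.** For `W/ℚ` globally minimal,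
elliptic, additive at `3` of census class (t′): a `ℤ₃`-model `V` of `W ⊗ ℚ₃` and a change of variables `T`
over `ℤ₃` with `T • V = y² = x³ + A₂x² + A₄x + A₆` and `(3 ∣ A₂, 3 ∥ A₄, 9 ∣ A₆, ord Δ = 3)` or
`(9 ∣ A₂, 27 ∥ A₄, 3⁵ ∣ A₆, ord Δ = 9)`. [cite: SilvermanATAEC1994, IV.9.4 and Table 4.1]
[cite: Papadopoulos1993, Table III (p = 3)] -/
theorem exists_padicInt_mediumForm_of_subTprime (hadd : Addv W 3) (hsub : SubTprime W 3) :
    ∃ (T : WeierstrassCurve.VariableChange ℤ_[3]) (V : WeierstrassCurve ℤ_[3]),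
      V.map (algebraMap ℤ_[3] ℚ_[3]) = W.baseChange ℚ_[3] ∧ (T • V).a₁ = 0 ∧ (T • V).a₃ = 0 ∧
      (((3 : ℤ_[3]) ∣ (T • V).a₂ ∧ (3 : ℤ_[3]) ∣ (T • V).a₄ ∧ ¬ (3 : ℤ_[3]) ^ 2 ∣ (T • V).a₄ ∧
          (3 : ℤ_[3]) ^ 2 ∣ (T • V).a₆ ∧ (addVal ℤ_[3] (T • V).Δ).toNat = 3) ∨
        ((3 : ℤ_[3]) ^ 2 ∣ (T • V).a₂ ∧ (3 : ℤ_[3]) ^ 3 ∣ (T • V).a₄ ∧ ¬ (3 : ℤ_[3]) ^ 4 ∣ (T • V).a₄ ∧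
          (3 : ℤ_[3]) ^ 5 ∣ (T • V).a₆ ∧ (addVal ℤ_[3] (T • V).Δ).toNat = 9)) := by
  classical
  -- the `3`-adic objects: `W' = W ⊗ ℚ₃`, its integral model `V`, the integral minimal model `M = D • V`
  set W' := W.baseChange ℚ_[3] with hW'
  have hmin : W'.minimal ℤ_[3] = (W'.exists_isMinimal ℤ_[3]).choose • W' := rfl
  haveI hW'min : W'.IsMinimal ℤ_[3] := by
    set v : HeightOneSpectrum (NumberField.RingOfIntegers ℚ) :=
      (Rat.HeightOneSpectrum.primesEquiv (R := NumberField.RingOfIntegers ℚ)).symm ⟨3, Fact.out⟩ with hv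
    have hv3 : ((Rat.HeightOneSpectrum.primesEquiv v : Nat.Primes) : ℕ) = 3 :=
      congrArg Subtype.val
        ((Rat.HeightOneSpectrum.primesEquiv (R := NumberField.RingOfIntegers ℚ)).apply_symm_apply ⟨3, _⟩)
    exact (isMinimalAt_iff_isMinimal_padic v 3 hv3 W).mp (WeierstrassCurve.IsGloballyMinimal.isMinimal v)
  set V := W'.integralModel ℤ_[3] with hVdef
  have hVmap : V.map (algebraMap ℤ_[3] ℚ_[3]) = W' := WeierstrassCurve.baseChange_integralModel_eq ℤ_[3] W'
  have hWΔ : W.Δ ≠ 0 := W.isUnit_Δ.ne_zero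
  have hW'Δ : W'.Δ = (W.Δ : ℚ_[3]) := by rw [hW', WeierstrassCurve.baseChange, WeierstrassCurve.map_Δ]; simp
  have hW'c₄ : W'.c₄ = (W.c₄ : ℚ_[3]) := by rw [hW', WeierstrassCurve.baseChange, WeierstrassCurve.map_c₄]; simp
  have hW'Δ0 : W'.Δ ≠ 0 := by rw [hW'Δ]; exact_mod_cast hWΔ
  have hVΔ : ((V.Δ : ℤ_[3]) : ℚ_[3]) = (W.Δ : ℚ_[3]) :=
    (WeierstrassCurve.integralModel_Δ_eq ℤ_[3] W').trans hW'Δ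
  have hVc₄ : ((V.c₄ : ℤ_[3]) : ℚ_[3]) = (W.c₄ : ℚ_[3]) :=
    (WeierstrassCurve.integralModel_c₄_eq ℤ_[3] W').trans hW'c₄
  have hV0 : V.Δ ≠ 0 := by
    intro h
    rw [h, PadicInt.coe_zero, eq_comm, Rat.cast_eq_zero] at hVΔ
    exact hWΔ hVΔ
  obtain ⟨D, -, hMD⟩ := WeierstrassCurve.exists_variableChange_integralModel_eq ℤ_[3] hmin hW'Δ0
  set M := D • V with hMdef
  haveI : Finite (ResidueField ℤ_[3]) :=
    Finite.of_equiv _ (PadicInt.residueField (p := 3)).toEquiv.symm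
  have h2 : IsUnit (2 : ℤ_[3]) := isUnit_two_padicInt_three
  have h3 : Irreducible (3 : ℤ_[3]) := by simpa using PadicInt.irreducible_p (p := 3)
  have e3 : ((3 : ℕ) : ℤ_[3]) = 3 := by norm_num
  have hmax : maximalIdeal ℤ_[3] = Ideal.span {(3 : ℤ_[3])} := by
    rw [PadicInt.maximalIdeal_eq_span_p, e3]
  have hmaxpow : ∀ n : ℕ, maximalIdeal ℤ_[3] ^ n = Ideal.span {((3 : ℕ) : ℤ_[3]) ^ n} := fun n ↦ by
    rw [PadicInt.maximalIdeal_eq_span_p, Ideal.span_singleton_pow]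
  have haddu : addVal ℤ_[3] ((D.u⁻¹ : ℤ_[3]ˣ) : ℤ_[3]) = 0 := by
    exact addVal_def ((D.u⁻¹ : ℤ_[3]ˣ) : ℤ_[3]) D.u⁻¹ h3 0 (by rw [pow_zero, mul_one])
  have hMΔ : M.Δ = ((D.u⁻¹ : ℤ_[3]ˣ) : ℤ_[3]) ^ 12 * V.Δ := by
    rw [hMdef, WeierstrassCurve.variableChange_Δ]
  have hMc₄ : M.c₄ = ((D.u⁻¹ : ℤ_[3]ˣ) : ℤ_[3]) ^ 4 * V.c₄ := by
    rw [hMdef, WeierstrassCurve.variableChange_c₄]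
  have hM0 : M.Δ ≠ 0 := by
    rw [hMΔ]; exact mul_ne_zero (pow_ne_zero _ (Units.ne_zero _)) hV0
  have hvalMΔ : (addVal ℤ_[3] M.Δ).toNat = (addVal ℤ_[3] V.Δ).toNat := by
    rw [hMΔ, addVal_mul, addVal_pow, haddu]; simp
  have hvalMc₄ : (addVal ℤ_[3] M.c₄).toNat = (addVal ℤ_[3] V.c₄).toNat := by
    rw [hMc₄, addVal_mul, addVal_pow, haddu]; simp
  have hWΔval : padicValRat 3 W.Δ = ((addVal ℤ_[3] V.Δ).toNat : ℤ) := by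
    have h := congrArg Padic.valuation hVΔ
    rw [PadicInt.valuation_coe, Padic.valuation_ratCast] at h
    rw [addVal_toNat_eq_valuation]; exact h.symm
  -- (a) additive reduction: `3 ∣ Δ(M)`, `3 ∣ c₄(M)`
  have hΔmem : M.Δ ∈ maximalIdeal ℤ_[3] := by
    have h := hadd.1
    rw [WeierstrassCurve.HasGoodReductionAtPrime,
      WeierstrassCurve.hasGoodReduction_iff_integralModel_Δ_notMem, hMD, not_not] at h
    exact h
  have hΔ3 : (3 : ℤ_[3]) ∣ M.Δ := by
    rw [hmax, Ideal.mem_span_singleton] at hΔmem; exact hΔmem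
  have hc₄mem : M.c₄ ∈ maximalIdeal ℤ_[3] := by
    by_contra hc
    apply hadd.2
    rw [WeierstrassCurve.HasMultiplicativeReductionAtPrime, WeierstrassCurve.hasMultiplicativeReduction_iff]
    refine ⟨inferInstance, ?_, ?_⟩
    · rw [← WeierstrassCurve.integralModel_Δ_eq ℤ_[3] (W'.minimal ℤ_[3]), hMD]
      exact (HeightOneSpectrum.valuation_lt_one_iff_mem _ _).mpr hΔmem
    · rw [← WeierstrassCurve.integralModel_c₄_eq ℤ_[3] (W'.minimal ℤ_[3]), hMD]
      exact (HeightOneSpectrum.valuation_eq_one_iff_notMem _).mpr hc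
  have hc₄3 : (3 : ℤ_[3]) ∣ M.c₄ := by
    rw [hmax, Ideal.mem_span_singleton] at hc₄mem; exact hc₄mem
  -- (b) `f₃ = 2`
  have hf : (addVal ℤ_[3] M.Δ).toNat + 1 - M.kodairaSymbolOfMinimal.numComponents = 2 := by
    have hf0 : W.conductorExponent (placeOf 3) = 2 := hsub.2.1
    rw [conductorExponent_placeOf_eq_padic 3 W] at hf0
    change (addVal ℤ_[3] ((W'.minimal ℤ_[3]).integralModel ℤ_[3]).Δ).toNat + 1 -
      ((W'.minimal ℤ_[3]).integralModel ℤ_[3]).kodairaSymbolOfMinimal.numComponents = 2 at hf0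
    rw [hMD] at hf0
    exact hf0
  -- (c) semistability index `∤ 2`: `6 ∤ ord Δ`
  have h6 : ¬ 6 ∣ (addVal ℤ_[3] M.Δ).toNat := by
    have he : ¬ semistabilityIndex W 3 ∣ 2 := hsub.2.2
    rw [semistabilityIndex_dvd_two_iff] at he
    intro h6
    apply he
    have hcast : (padicValInt 3 W.minimalDiscriminantInt : ℤ) = ((addVal ℤ_[3] M.Δ).toNat : ℤ) := by
      rw [← padicValRat_Δ_eq W 3, hWΔval, hvalMΔ]
    have hnat : padicValInt 3 W.minimalDiscriminantInt = (addVal ℤ_[3] M.Δ).toNat := by exact_mod_cast hcast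
    rw [hnat]; exact h6
  -- (d) potentially good: `c₄ = 0 ∨ ord Δ ≤ 3 ord c₄`
  have hj : M.c₄ = 0 ∨ (addVal ℤ_[3] M.Δ).toNat ≤ 3 * (addVal ℤ_[3] M.c₄).toNat := by
    by_cases hc4 : W.c₄ = 0
    · left
      rw [hc4, Rat.cast_zero] at hVc₄
      have hV : V.c₄ = 0 := PadicInt.coe_eq_zero.mp hVc₄
      rw [hMc₄, hV, mul_zero]
    · right
      have hjv : 0 ≤ padicValRat 3 W.j := not_lt.mp hsub.1
      have hVc0 : V.c₄ ≠ 0 := by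
        intro h
        rw [h, PadicInt.coe_zero, eq_comm, Rat.cast_eq_zero] at hVc₄
        exact hc4 hVc₄
      have hWc₄val : padicValRat 3 W.c₄ = ((addVal ℤ_[3] V.c₄).toNat : ℤ) := by
        have h := congrArg Padic.valuation hVc₄
        rw [PadicInt.valuation_coe, Padic.valuation_ratCast] at h
        rw [addVal_toNat_eq_valuation]; exact h.symm
      have hj' : padicValRat 3 W.j = 3 * padicValRat 3 W.c₄ - padicValRat 3 W.Δ := by
        rw [WeierstrassCurve.j, Units.val_inv_eq_inv_val, WeierstrassCurve.coe_Δ',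
          padicValRat.mul (inv_ne_zero hWΔ) (pow_ne_zero _ hc4), padicValRat.inv, padicValRat.pow]
        ring
      rw [hvalMΔ, hvalMc₄]
      have : ((addVal ℤ_[3] V.Δ).toNat : ℤ) ≤ 3 * ((addVal ℤ_[3] V.c₄).toNat : ℤ) := by
        rw [← hWΔval, ← hWc₄val]; linarith
      exact_mod_cast this
  -- (e) minimality of `M` (Step 11 of Tate's algorithm never fires)
  have hmin11 : ∀ D' : WeierstrassCurve.VariableChange ℤ_[3], D'.u = 1 →
      uniformizer ℤ_[3] ∣ (D' • M).a₁ → uniformizer ℤ_[3] ^ 2 ∣ (D' • M).a₂ →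
      uniformizer ℤ_[3] ^ 3 ∣ (D' • M).a₃ → uniformizer ℤ_[3] ^ 4 ∣ (D' • M).a₄ →
      uniformizer ℤ_[3] ^ 6 ∣ (D' • M).a₆ → False := by
    intro D' _ h1 h2' h3' h4 h6'
    have hM' : (M.baseChange ℚ_[3]).IsMinimal ℤ_[3] := by
      rw [← hMD, WeierstrassCurve.baseChange_integralModel_eq ℤ_[3] (W'.minimal ℤ_[3])]
      infer_instance
    exact not_isMinimal_of_pow_dvd ℚ_[3] hM0 D' h1 h2' h3' h4 h6' hM'
  -- THE LOCAL THEOREM: medium form `T • V = (C * D) • V` of type III / III*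
  obtain ⟨C, hCu, hA₁, hA₃, hcases⟩ :=
    exists_mediumForm_of_tprime h2 h3 M hM0 hmin11 hΔ3 hc₄3 hf h6 hj
  have hT : C • M = (C * D) • V := by rw [hMdef, mul_smul]

  have hTΔ : ((C * D) • V).Δ = M.Δ := by rw [← hT, Δ_smul_of_u_eq_one hCu]
  have hdvd : ∀ {x : ℤ_[3]} {n : ℕ}, x ∈ maximalIdeal ℤ_[3] ^ n → (3 : ℤ_[3]) ^ n ∣ x :=
    fun {x n} h ↦ by rw [hmaxpow, Ideal.mem_span_singleton, e3] at h; exact h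
  have h30 : ∀ n : ℕ, (3 : ℤ_[3]) ^ n ∣ (0 : ℤ_[3]) := fun n ↦ dvd_zero _
  refine ⟨C * D, V, hVmap, by rw [← hT]; exact hA₁, by rw [← hT]; exact hA₃, ?_⟩
  rw [← hT, Δ_smul_of_u_eq_one hCu]
  rcases hcases with ⟨h₂, h₄, h₆, hv⟩ | ⟨h₂, h₄, h₆, hv⟩
  · refine Or.inl ⟨by simpa using hdvd (n := 1) (by simpa using h₂),
      by simpa using hdvd (n := 1) (by simpa using h₄), fun h9 ↦ ?_, hdvd h₆, hv⟩
    -- `9 ∣ A₄` would force `3⁴ ∣ Δ`, contradicting `ord Δ = 3`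
    have hΔ4 : (3 : ℤ_[3]) ^ 4 ∣ (C • M).Δ :=
      pow_dvd_Δ_of_pow_dvd_a 3 (C • M) (i₁ := 10) (i₂ := 1) (i₃ := 10) (i₄ := 2) (i₆ := 2) 4
        (by rw [hA₁]; exact h30 _) (by simpa using hdvd (n := 1) (by simpa using h₂))
        (by rw [hA₃]; exact h30 _) h9 (hdvd h₆) 1 2 2 3
        (by norm_num) (by norm_num) (by norm_num) (by norm_num) (by norm_num) (by norm_num)
        (by norm_num) (by norm_num) (by norm_num) (by norm_num) (by norm_num)
        (by norm_num) (by norm_num) (by norm_num) (by norm_num)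
    rw [Δ_smul_of_u_eq_one hCu] at hΔ4
    have := le_addVal_toNat_of_pow_dvd h3 hM0 hΔ4
    omega
  · refine Or.inr ⟨hdvd h₂, hdvd h₄, fun h81 ↦ ?_, hdvd h₆, hv⟩
    -- `81 ∣ A₄` would force `3¹⁰ ∣ Δ`, contradicting `ord Δ = 9`
    have hΔ10 : (3 : ℤ_[3]) ^ 10 ∣ (C • M).Δ :=
      pow_dvd_Δ_of_pow_dvd_a 3 (C • M) (i₁ := 20) (i₂ := 2) (i₃ := 20) (i₄ := 4) (i₆ := 5) 10
        (by rw [hA₁]; exact h30 _) (hdvd h₂) (by rw [hA₃]; exact h30 _) h81 (hdvd h₆) 2 4 5 7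
        (by norm_num) (by norm_num) (by norm_num) (by norm_num) (by norm_num) (by norm_num)
        (by norm_num) (by norm_num) (by norm_num) (by norm_num) (by norm_num)
        (by norm_num) (by norm_num) (by norm_num) (by norm_num)
    rw [Δ_smul_of_u_eq_one hCu] at hΔ10
    have := le_addVal_toNat_of_pow_dvd h3 hM0 hΔ10
    omega

end Summit.BirchSwinnertonDyer.BirchSwinnertonDyer.Theorems.SolventPairLowerBound

end
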